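import Summits.QuantumFields.YangMills.Theorems.BalabanUVNodesN16AveragingPin
import HarnessLib

/-!
# YM-DAG node N16 (NE3), the located averaging pin (42) ↔ (0.4) — part 34: THE ACTION SANDWICH FOR AN ARBITRARY AVERAGING SCHEME `s`, and the ONE located input of the
# (42)→(0.4) pin for N16's END (A) that it isolates: the ONE-STEP ACTION DISCREPANCY `A^{(k)}(step42 U) − A^{(k)}(s_{k+1} U)` of the two averages of the same competitor

Cell `pub-ymgap`, width seat `pub-ymgap-dag-n16-w3` (director-ym №197 ∕ HUMAN RULING D-0149), generation 9; part 34 of the W1b lineage (g0's part 0a `…N16AveragingPin`: `avgIterS`,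
`admissibleS`, `IsMinimiserS`, `step42`, `step04`; pub-balaban's `MinimalActionSandwich` = the sandwich for (43), `MinimalActionLevels.levelAction_succ_eq` = [Balaban1985Averaging]'s
averaging-deficit identity for (42)).  `--kind proof --supports stmt-QuantumFields-27366 --as helper` (K3⁸, KEY MAP v2; count-neutral; 0 `def`).  `bears_on: R4∕N16`.

WHY (the self-refereed correction of part 28∕33).  N16's END (A) — `|A_{k+1}(V) − A_k(V)| ≤ Cθ^k·vol` for the (43)-constrained minimal actions — is proved in pub-balaban by the
TWO-COMPETITOR SANDWICH (`MinimalActionSandwich`: the averaged finer minimiser competes in run `k`, a refinement of the coarser minimiser competes in run `k+1`), NOT by comparing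
with another scheme.  The (42)→(0.4) pin for END (A) is therefore NOT «the two minimal actions are close» (they have different limits: different averaging functionals at unit block
scale) but «THE SAME SANDWICH RUNS FOR THE (0.4) SCHEME»; this file runs it for an ARBITRARY depth-indexed scheme `s` and isolates what is new:
 * §1 `mem_admissibleS_of_succ` ∕ `mem_admissibleS_succ_of` — admissibility across one `s`-step (g0's `avgIterS_succ`).
 * §2 ★★ THE GENERIC SANDWICH: `levelAction_isMinimiserS_le_succ` ∕ `levelAction_isMinimiserS_succ_le` (the two halves); ★★ `isMinimiserS_sandwich` — for `s`-minimisers `U_A` (run `k`) and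
   `U_B` (run `k+1`) at the same datum, with `s (k+1) U_B ∈ 𝒞 k` and a refinement `Ũ ∈ 𝒞 (k+1)`, `s (k+1) Ũ = U_A`:
   `|A^{(k)}(U_A) − A^{(k+1)}(U_B)| ≤ max |𝔇ˢ(U_B)| |𝔇ˢ(Ũ)|` with the GENERIC ONE-STEP DEFICIT `𝔇ˢ(U) := A^{(k+1)}(U) − A^{(k)}(s (k+1) U)` (no definition: written out).
 * §3 ★★★ THE SPLIT: `𝔇ˢ(U) = −w^{k+1}·𝓓₄₂(U) + [A^{(k)}(step42 U) − A^{(k)}(s (k+1) U)]` (`levelAction_succ_eq`: the first term is [Balaban1985Averaging]'s deficit of (42), bounded in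
   the tree by row NE3-R2's wall `MinimalActionSandwich.abs_deficit_level_le`; the second is THE ONE-STEP ACTION DISCREPANCY of the two averages OF THE SAME CONFIGURATION — a sum of
   LOCAL GAUGE-INVARIANT terms (plaquette traces), so parts 22∕25∕26's per-bond LOCAL-gauge comparison is the right currency for it, no global gauge needed; numerically THIRD order per
   coarse plaquette, `|tr P₄₂ − tr P₀₄| ≈ 0.1ε³` (g8 `W3-PIN-ANATOMY-v6∕v7`), which is exactly N16's rate `θ = L^{−2}` after summing over `(N L^k)^4` plaquettes of size `εL^{−2k}`).
   `abs_genDeficit_le` — `|𝔇ˢ(U)| ≤ w^{k+1}|𝓓₄₂(U)| + |D(U)|`.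
 * §4 ★★★ `abs_levelAction_isMinimiserS_sub_le_wall_add` — THE SANDWICH WITH THE WALL PLUGGED AND THE DISCREPANCY DISPLAYED: for the two competitors `U(N)`-valued, `(N·L^{k+1})`-periodic,
   `a`-small-field with `‖∇F‖² ≤ G` (pub-balaban's wall hypotheses VERBATIM) and one-step action discrepancies `≤ D`:
   `|A^{(k)}(U_A) − A^{(k+1)}(U_B)| ≤ w^{k+1}·wallConstNA(d,L)·(G + a³(N L^k)^d) + D`; `abs_sInf_succ_sub_sInf_le_wall_add` — the inf form an `ActionRate` END reads.
READING (honest; for the planners, D-0014).  END (A) for the (0.4) scheme of record ⇐ [existence + Theorem-1-type regularity of (0.4)-CONSTRAINED minimisers and refinements — g0's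
`H7Body N (step04 F N) F`-type inputs, [Balaban1987RG1] p. 254's claim, displayed since g0] + [class propagation of `step04`] + [the tree's wall] + [THE ONE-STEP ACTION DISCREPANCY
BOUND `|A^{(k)}(step42 U) − A^{(k)}(step04 U)| ≤ C_D θ^k vol` for regular `U` — NEW located input; second order per plaquette is what parts 22∕25∕26 give (not enough: no decay in `k`),
third order (the numerics; structurally: the second-order exponent discrepancy is a sum of commutators, traceless) is what is needed and is NOT proved].  Nothing of this is proved
here beyond the sandwich algebra.

HONEST FRAMING.  [folklore] order bookkeeping BY NAME over g0's `avgIterS`∕`admissibleS`∕`IsMinimiserS` and pub-balaban's `levelAction_succ_eq` ∕ `abs_deficit_level_le`; 0 `def`,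
0 `sorry`, no `instance`, no `notation`; no minimiser constructed (minimisers are displayed hypotheses, as in `MinimalActionSandwich`); NO estimate proved; nothing of Bałaban asserted;
K3⁸ stubs `stub_rates13HV` ∕ `stub_expansion13HV` NOT touched; N16 ∕ NE3 NOT discharged; count-neutral (typed 28∕28 · discharged 5∕27 work-bound, A 5∕28 — unmoved).  One finite
four-torus programme at fixed `ε` — the Yang–Mills mass gap (Clay) is NOT proved by any of this; R4 closes the conditional finite-𝕋⁴ rung `BalabanLadder.UV` only; nothing
continuum ∕ ℝ⁴ ∕ OS.
-/

set_option autoImplicit false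

open scoped BigOperators Matrix Matrix.Norms.L2Operator
open NormedSpace

namespace Summit.QuantumFields.YangMills.BalabanUVNodes.N16SchemeSandwich

open Literature.MathematicalPhysics.QuantumFieldTheory.Balaban1983to89
open B7Prop1Explicit B7Prop2Explicit
open T4AveragingDeficitWall (IsUnitaryCfg SmallField deficit blockWindow gradFluxSq)
open T4AveragingDeficitWallBoundary (IsPeriodicCfg periodBox)
open T4AveragingDeficitNonAbelian (wallConstNA wallConstNA_nonneg)
open Summit.QuantumFields.BalabanUV.T4Continuum
open MinimalActionLevels (levelAction stepWt stepWt_pos levelAction_succ_eq)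
open MinimalActionSandwich (abs_deficit_level_le)
open Summit.QuantumFields.YangMills.BalabanUVNodes.N16AveragingPin (avgIterS avgIterS_succ step42 admissibleS mem_admissibleS_iff IsMinimiserS)

noncomputable section

variable {d : ℕ} {n : Type*} [Fintype n] [DecidableEq n]
variable {s : ℕ → (Site d → Fin d → (Matrix n n ℂ)ˣ) → (Site d → Fin d → (Matrix n n ℂ)ˣ)}
  {𝒞 : ℕ → Set (Site d → Fin d → (Matrix n n ℂ)ˣ)} {L N k : ℕ}

/-! ## §1 Admissibility across one `s`-step -/

/-- **DOWN**: the one-step `s`-average of an `s`-admissible configuration of run `k+1` is `s`-admissible for run `k` as soon as it lies in the class `𝒞 k`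
(`avgIterS s k (s (k+1) U) = avgIterS s (k+1) U`). [folklore] -/
theorem mem_admissibleS_of_succ {V U : Site d → Fin d → (Matrix n n ℂ)ˣ} (hU : U ∈ admissibleS s 𝒞 (k + 1) V) (h𝒞 : s (k + 1) U ∈ 𝒞 k) :
    s (k + 1) U ∈ admissibleS s 𝒞 k V :=
  ⟨h𝒞, by rw [← avgIterS_succ]; exact hU.2⟩

/-- **UP**: a configuration of class `𝒞 (k+1)` whose one-step `s`-average is `s`-admissible for run `k` is `s`-admissible for run `k+1`. [folklore] -/
theorem mem_admissibleS_succ_of {V Ut Ua : Site d → Fin d → (Matrix n n ℂ)ˣ} (hUt : Ut ∈ 𝒞 (k + 1)) (havg : s (k + 1) Ut = Ua)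
    (hUa : Ua ∈ admissibleS s 𝒞 k V) : Ut ∈ admissibleS s 𝒞 (k + 1) V :=
  ⟨hUt, by rw [avgIterS_succ, havg]; exact hUa.2⟩

/-! ## §2 The generic two-competitor sandwich -/

/-- **UPPER HALF**: the averaged finer minimiser competes in the coarser run —
`A^{(k)}(U_A) ≤ A^{(k+1)}(U_B) − 𝔇ˢ(U_B)`, `𝔇ˢ(U) := A^{(k+1)}(U) − A^{(k)}(s (k+1) U)`. [folklore] -/
theorem levelAction_isMinimiserS_le_succ {V UA UB : Site d → Fin d → (Matrix n n ℂ)ˣ} (hA : IsMinimiserS d s 𝒞 L N k V UA) (hB : IsMinimiserS d s 𝒞 L N (k + 1) V UB)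
    (hW : s (k + 1) UB ∈ 𝒞 k) :
    levelAction d L N k UA ≤ levelAction d L N (k + 1) UB - (levelAction d L N (k + 1) UB - levelAction d L N k (s (k + 1) UB)) := by
  have h := hA.le _ (mem_admissibleS_of_succ hB.mem hW)
  linarith

/-- **LOWER HALF**: a refinement of the coarser minimiser competes in the finer run —
`A^{(k+1)}(U_B) ≤ A^{(k)}(U_A) + 𝔇ˢ(Ũ)` for `Ũ ∈ 𝒞 (k+1)` with `s (k+1) Ũ = U_A`. [folklore] -/
theorem levelAction_isMinimiserS_succ_le {V UA UB Ut : Site d → Fin d → (Matrix n n ℂ)ˣ} (hA : IsMinimiserS d s 𝒞 L N k V UA) (hB : IsMinimiserS d s 𝒞 L N (k + 1) V UB)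
    (hUt : Ut ∈ 𝒞 (k + 1)) (havg : s (k + 1) Ut = UA) :
    levelAction d L N (k + 1) UB ≤ levelAction d L N k UA + (levelAction d L N (k + 1) Ut - levelAction d L N k (s (k + 1) Ut)) := by
  have h := hB.le _ (mem_admissibleS_succ_of hUt havg hA.mem)
  rw [havg]
  linarith

/-- **★★ THE SANDWICH FOR THE SCHEME `s`**: `|A^{(k)}(U_A) − A^{(k+1)}(U_B)| ≤ max |𝔇ˢ(U_B)| |𝔇ˢ(Ũ)|` — the consecutive constrained minimal actions differ by at most the larger of
the two competitors' GENERIC one-step deficits. [folklore] -/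
theorem isMinimiserS_sandwich {V UA UB Ut : Site d → Fin d → (Matrix n n ℂ)ˣ} (hA : IsMinimiserS d s 𝒞 L N k V UA) (hB : IsMinimiserS d s 𝒞 L N (k + 1) V UB)
    (hW : s (k + 1) UB ∈ 𝒞 k) (hUt : Ut ∈ 𝒞 (k + 1)) (havg : s (k + 1) Ut = UA) :
    |levelAction d L N k UA - levelAction d L N (k + 1) UB|
      ≤ max |levelAction d L N (k + 1) UB - levelAction d L N k (s (k + 1) UB)| |levelAction d L N (k + 1) Ut - levelAction d L N k (s (k + 1) Ut)| := by
  have hup := levelAction_isMinimiserS_le_succ hA hB hW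
  have hlo := levelAction_isMinimiserS_succ_le hA hB hUt havg
  rw [abs_le]
  constructor
  · have := le_abs_self (levelAction d L N (k + 1) Ut - levelAction d L N k (s (k + 1) Ut))
    have := le_max_right |levelAction d L N (k + 1) UB - levelAction d L N k (s (k + 1) UB)| |levelAction d L N (k + 1) Ut - levelAction d L N k (s (k + 1) Ut)|
    linarith
  · have := neg_le_abs (levelAction d L N (k + 1) UB - levelAction d L N k (s (k + 1) UB))
    have := le_max_left |levelAction d L N (k + 1) UB - levelAction d L N k (s (k + 1) UB)| |levelAction d L N (k + 1) Ut - levelAction d L N k (s (k + 1) Ut)|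
    linarith

/-! ## §3 The split of the generic deficit: (42)'s averaging deficit + the one-step action discrepancy -/

/-- **★★★ THE SPLIT**: `𝔇ˢ(U) = A^{(k+1)}(U) − A^{(k)}(s (k+1) U) = −w^{k+1}·𝓓₄₂(U) + [A^{(k)}(step42 U) − A^{(k)}(s (k+1) U)]` — pub-balaban's deficit identity `levelAction_succ_eq`
([Balaban1985Averaging]'s (42)-deficit on the period window) plus THE ONE-STEP ACTION DISCREPANCY `D(U)` of the two averages of the same configuration. [folklore] -/
theorem genDeficit_eq (hL : 1 ≤ L) (U : Site d → Fin d → (Matrix n n ℂ)ˣ) :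
    levelAction d L N (k + 1) U - levelAction d L N k (s (k + 1) U)
      = -(((stepWt d L)⁻¹) ^ (k + 1) * deficit L U (blockWindow L (periodBox (N * L ^ k))))
        + (levelAction d L N k (step42 L U) - levelAction d L N k (s (k + 1) U)) := by
  rw [levelAction_succ_eq L N k hL U]
  show levelAction d L N k (step42 L U) - _ - _ = _
  ring

/-- Hence `|𝔇ˢ(U)| ≤ w^{k+1}·|𝓓₄₂(U)| + |D(U)|`. [folklore] -/
theorem abs_genDeficit_le (hL : 1 ≤ L) (U : Site d → Fin d → (Matrix n n ℂ)ˣ) :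
    |levelAction d L N (k + 1) U - levelAction d L N k (s (k + 1) U)|
      ≤ ((stepWt d L)⁻¹) ^ (k + 1) * |deficit L U (blockWindow L (periodBox (N * L ^ k)))|
        + |levelAction d L N k (step42 L U) - levelAction d L N k (s (k + 1) U)| := by
  have hc : 0 ≤ ((stepWt d L)⁻¹) ^ (k + 1) := pow_nonneg (inv_nonneg.mpr (stepWt_pos (d := d) L hL).le) _
  rw [genDeficit_eq hL U]
  refine (abs_add_le _ _).trans ?_
  rw [abs_neg, abs_mul, abs_of_nonneg hc]

/-- For the (43) scheme itself the discrepancy term vanishes (`s = step42`): the generic deficit IS `−w^{k+1}·𝓓₄₂` (consistency with `MinimalActionSandwich`). [folklore] -/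
theorem genDeficit_step42 (hL : 1 ≤ L) (U : Site d → Fin d → (Matrix n n ℂ)ˣ) :
    levelAction d L N (k + 1) U - levelAction d L N k (step42 L U)
      = -(((stepWt d L)⁻¹) ^ (k + 1) * deficit L U (blockWindow L (periodBox (N * L ^ k)))) := by
  have h := genDeficit_eq (s := fun _ => step42 L) (N := N) (k := k) hL U
  simpa using h

/-! ## §4 The sandwich with the wall plugged in and the discrepancy displayed -/

/-- **★★★ THE SANDWICH FOR `s` WITH ROW NE3-R2's WALL AND THE ONE-STEP ACTION DISCREPANCY DISPLAYED.**  If both competitors of run `k+1` (the `s`-minimiser `U_B` and the refinement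
`Ũ` of the run-`k` minimiser) are `U(N)`-valued, `(N·L^{k+1})`-periodic, in `SmallField · a` with `512(d+1)(d+4)L²a ≤ 1` and `‖∇F‖² ≤ G` on the period (pub-balaban's
`abs_deficit_level_le` hypotheses VERBATIM), and their ONE-STEP ACTION DISCREPANCIES are at most `D`, `|A^{(k)}(step42 U) − A^{(k)}(s (k+1) U)| ≤ D`, then
`|A^{(k)}(U_A) − A^{(k+1)}(U_B)| ≤ w^{k+1}·wallConstNA(d,L)·(G + a³(N L^k)^d) + D` — pub-balaban's `abs_minAct_sub_minAct_le_wall` for (43) plus exactly ONE new displayed letter `D`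
(for `s = step04 F N`: the located input of the (42)→(0.4) pin for END (A); `D = 0` for `s = step42`). [folklore] -/
theorem abs_levelAction_isMinimiserS_sub_le_wall_add [Nonempty n] (hL : 1 ≤ L) (hN : 1 ≤ N) {V UA UB Ut : Site d → Fin d → (Matrix n n ℂ)ˣ}
    (hA : IsMinimiserS d s 𝒞 L N k V UA) (hB : IsMinimiserS d s 𝒞 L N (k + 1) V UB)
    (hW : s (k + 1) UB ∈ 𝒞 k) (hUt : Ut ∈ 𝒞 (k + 1)) (havg : s (k + 1) Ut = UA)
    (hBu : IsUnitaryCfg UB) (hBp : IsPeriodicCfg UB ((N * L ^ (k + 1) : ℕ) : ℤ)) (hTu : IsUnitaryCfg Ut) (hTp : IsPeriodicCfg Ut ((N * L ^ (k + 1) : ℕ) : ℤ))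
    {a G D : ℝ} (ha : 0 ≤ a) (hsmall : 512 * (d + 1) * (d + 4) * (L : ℝ) ^ 2 * a ≤ 1) (hBa : SmallField UB a) (hTa : SmallField Ut a)
    (hBG : gradFluxSq UB (periodBox (N * L ^ (k + 1))) ≤ G) (hTG : gradFluxSq Ut (periodBox (N * L ^ (k + 1))) ≤ G)
    (hBD : |levelAction d L N k (step42 L UB) - levelAction d L N k (s (k + 1) UB)| ≤ D)
    (hTD : |levelAction d L N k (step42 L Ut) - levelAction d L N k (s (k + 1) Ut)| ≤ D) :
    |levelAction d L N k UA - levelAction d L N (k + 1) UB|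
      ≤ ((stepWt d L)⁻¹) ^ (k + 1) * (wallConstNA d L * (G + a ^ 3 * ((N * L ^ k : ℕ) : ℝ) ^ d)) + D := by
  have hc : 0 ≤ ((stepWt d L)⁻¹) ^ (k + 1) := pow_nonneg (inv_nonneg.mpr (stepWt_pos (d := d) L hL).le) _
  have hWc := wallConstNA_nonneg (d := d) L
  have hwallB : |deficit L UB (blockWindow L (periodBox (N * L ^ k)))| ≤ wallConstNA d L * (G + a ^ 3 * ((N * L ^ k : ℕ) : ℝ) ^ d) := by
    refine (abs_deficit_level_le hL hN hBu hBp ha hsmall hBa).trans ?_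
    exact mul_le_mul_of_nonneg_left (by linarith) hWc
  have hwallT : |deficit L Ut (blockWindow L (periodBox (N * L ^ k)))| ≤ wallConstNA d L * (G + a ^ 3 * ((N * L ^ k : ℕ) : ℝ) ^ d) := by
    refine (abs_deficit_level_le hL hN hTu hTp ha hsmall hTa).trans ?_
    exact mul_le_mul_of_nonneg_left (by linarith) hWc
  have h1 := (abs_genDeficit_le (s := s) (N := N) (k := k) hL UB).trans (add_le_add (mul_le_mul_of_nonneg_left hwallB hc) hBD)
  have h2 := (abs_genDeficit_le (s := s) (N := N) (k := k) hL Ut).trans (add_le_add (mul_le_mul_of_nonneg_left hwallT hc) hTD)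
  exact (isMinimiserS_sandwich hA hB hW hUt havg).trans (max_le h1 h2)

/-- **★★★ THE INF FORM** (what an `ActionRate`-type END reads): if at a datum `V` the `s`-constrained problems of runs `k` and `k+1` have minimisers `U_A`, `U_B` as above, then
`|inf A^{(k+1)}(admissibleS s 𝒞 (k+1) V) − inf A^{(k)}(admissibleS s 𝒞 k V)| ≤ w^{k+1}·wallConstNA(d,L)·(G + a³(N L^k)^d) + D` (a minimiser realises the infimum). [folklore] -/
theorem abs_sInf_succ_sub_sInf_le_wall_add [Nonempty n] (hL : 1 ≤ L) (hN : 1 ≤ N) {V UA UB Ut : Site d → Fin d → (Matrix n n ℂ)ˣ}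
    (hA : IsMinimiserS d s 𝒞 L N k V UA) (hB : IsMinimiserS d s 𝒞 L N (k + 1) V UB)
    (hW : s (k + 1) UB ∈ 𝒞 k) (hUt : Ut ∈ 𝒞 (k + 1)) (havg : s (k + 1) Ut = UA)
    (hBu : IsUnitaryCfg UB) (hBp : IsPeriodicCfg UB ((N * L ^ (k + 1) : ℕ) : ℤ)) (hTu : IsUnitaryCfg Ut) (hTp : IsPeriodicCfg Ut ((N * L ^ (k + 1) : ℕ) : ℤ))
    {a G D : ℝ} (ha : 0 ≤ a) (hsmall : 512 * (d + 1) * (d + 4) * (L : ℝ) ^ 2 * a ≤ 1) (hBa : SmallField UB a) (hTa : SmallField Ut a)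
    (hBG : gradFluxSq UB (periodBox (N * L ^ (k + 1))) ≤ G) (hTG : gradFluxSq Ut (periodBox (N * L ^ (k + 1))) ≤ G)
    (hBD : |levelAction d L N k (step42 L UB) - levelAction d L N k (s (k + 1) UB)| ≤ D)
    (hTD : |levelAction d L N k (step42 L Ut) - levelAction d L N k (s (k + 1) Ut)| ≤ D) :
    |sInf (levelAction d L N (k + 1) '' admissibleS s 𝒞 (k + 1) V) - sInf (levelAction d L N k '' admissibleS s 𝒞 k V)|
      ≤ ((stepWt d L)⁻¹) ^ (k + 1) * (wallConstNA d L * (G + a ^ 3 * ((N * L ^ k : ℕ) : ℝ) ^ d)) + D := by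
  have hAeq : sInf (levelAction d L N k '' admissibleS s 𝒞 k V) = levelAction d L N k UA := by
    refine IsLeast.csInf_eq ⟨Set.mem_image_of_mem _ hA.mem, ?_⟩
    rintro _ ⟨U', hU', rfl⟩; exact hA.le U' hU'
  have hBeq : sInf (levelAction d L N (k + 1) '' admissibleS s 𝒞 (k + 1) V) = levelAction d L N (k + 1) UB := by
    refine IsLeast.csInf_eq ⟨Set.mem_image_of_mem _ hB.mem, ?_⟩
    rintro _ ⟨U', hU', rfl⟩; exact hB.le U' hU'
  rw [hAeq, hBeq, abs_sub_comm]
  exact abs_levelAction_isMinimiserS_sub_le_wall_add hL hN hA hB hW hUt havg hBu hBp hTu hTp ha hsmall hBa hTa hBG hTG hBD hTD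

end

end Summit.QuantumFields.YangMills.BalabanUVNodes.N16SchemeSandwich
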